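import Summits.AnomalousDissipation.AnomalousDissipation.Theorems.SolenoidalFractalHomogenisationLagrangianStepSidebandLadderCrushSlotNu
import Summits.AnomalousDissipation.AnomalousDissipation.Theorems.SolenoidalFractalHomogenisationLagrangianStepSidebandPickup
import HarnessLib

/-!
# K1L_D `stub_D1_V0thg` (stmt-AnomalousDissipation-27980), R3′ lane «SidebandTailCrushing» — file F4h∘F5 (vi): the full-slot ν-scaled ladder crush
# with the constants PACKAGED (`∃ Ccr ccr C_R > 0`, ν-free, depending only on the word, the slot, the ladder base point and the window shape `l, h, β`)

Helper file of route `SolenoidalFractalHomogenisation` (`--supports stmt-AnomalousDissipation-27980 --as helper`; one-generation hand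
`leafhand-ad-solenoidalfractalh-1` g0, road E-c).  `ladder_crush_slot_nu_exists` is `Sideband.ladder_crush_slot_nu` with the cube root
`κ = (4π²l/(28S₀²))^{1/3}` supplied, `a = 2π|êᵢ·z₀|‖αᵢ‖ > 0` derived from the hopping hypothesis (`norm_slotAmp`, `norm_latticeVec_pos`) and the explicit
constants hidden behind an existential — the turnkey form for the R3′-2 spine: given the word `W₁`, the slot `i`, the ladder base point `z₀` with `êᵢ·z₀ ≠ 0`, a
bound `M ≥ ‖mᵢ‖_∞` and the ν-free window shape `l, h > 0`, `β ≥ 0` satisfying the odd-viscosity feasibility `128(β/(2l)·(1+Mo))² ≤ S₀`, there are ν-FREE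
`Ccr, ccr, C_R > 0` such that for every truncation radius `R` with `C_R ≤ (R − M)r²`, every `r = ν^{1/3} ∈ (0,1]`, every tensor in the window
`NearIso 𝔸 (r³l) (r³h)`, `OddSmall 𝔸 (r³β)`, every `γ₁ ≥ 0` and every solution `u` of the truncated sideband system on the closed slot `i` (of duration
`τᵢ ≥ 2/r`) starting in the ladder subspace: `‖u(startᵢ + τᵢ)‖² ≤ Ccr·exp(−ccr·r²·τᵢ/2)·‖u(startᵢ)‖²`.  No definitions, no sorry.
NOT a proof of `stub_D1_V0thg`, of K1L_D or of AD; rung F-D1.A0 infrastructure.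
-/

set_option linter.dupNamespace false -- single-conjunct summit: `Summit.AnomalousDissipation.AnomalousDissipation.…` is the mandated namespace

noncomputable section

namespace Summit.AnomalousDissipation.AnomalousDissipation.Theorems.SolenoidalFractalHomogenisation.LagrangianStep.Sideband

open Set Complex
open scoped InnerProductSpace
open Literature.Analysis Literature.Analysis.FunctionSpaces Literature.Analysis.FunctionSpaces.Torus
open Literature.Analysis.FluidPDE Literature.Analysis.FluidPDE.Torus Literature.Analysis.FluidPDE.LatticeShear

variable {k₀ : ℕ}

/-- The ladder coupling constant `a = 2π|êᵢ·z₀|‖αᵢ‖` of a hopping ladder is positive. [cite: MeshalkinSinai1961, pp. 1700–1705] -/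
theorem ladderCoupling_pos (W₁ : LatticeWord k₀) (i : Fin k₀) (z₀ : Fin 3 → ℤ) (hhop : ∑ a, (W₁.phase i).e a * (z₀ a : ℝ) ≠ 0) :
    0 < 2 * Real.pi * |∑ a, (W₁.phase i).e a * (z₀ a : ℝ)| * ‖slotAmp W₁ i‖ := by
  have h1 : 0 < |∑ a, (W₁.phase i).e a * (z₀ a : ℝ)| := abs_pos.mpr hhop
  have h2 : 0 < ‖slotAmp W₁ i‖ := by
    rw [norm_slotAmp]
    have := norm_latticeVec_pos (W₁.phase i)
    positivity
  positivity

set_option maxHeartbeats 400000 in -- pre-budgeted (ops-buildfix rule): large statement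
/-- **FULL-SLOT ν-SCALED LADDER CRUSH, CONSTANTS PACKAGED**: ν-free `Ccr, ccr, C_R > 0` (depending on `W₁, i, z₀, l, h, β` only) with
`‖u(startᵢ + τᵢ)‖² ≤ Ccr·exp(−ccr·r²·τᵢ/2)·‖u(startᵢ)‖²` for every admissible `R, r, 𝔸, γ₁, u` (see the module docstring).
[cite: BedrossianCotiZelati2017, §2 (hypocoercivity, enhanced dissipation)] [cite: Avron1998OddViscosity, §2 eq. (1)-(2)] -/
theorem ladder_crush_slot_nu_exists (W₁ : LatticeWord k₀) (i : Fin k₀) (z₀ : Fin 3 → ℤ)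
    (hhop : ∑ a, (W₁.phase i).e a * (z₀ a : ℝ) ≠ 0) {M : ℝ} (hM : ∀ j, |((W₁.phase i).m j : ℝ)| ≤ M)
    {l h β : ℝ} (hl : 0 < l) (hh : 0 < h) (hβ : 0 ≤ β)
    -- the ν-free abbreviations (instantiate with `rfl`) and the odd-viscosity feasibility
    {a m₂ S₀ Mo : ℝ} (ha : a = 2 * Real.pi * |∑ a, (W₁.phase i).e a * (z₀ a : ℝ)| * ‖slotAmp W₁ i‖)
    (hm₂ : m₂ = freqNormSq (W₁.phase i).m)
    (hS₀ : S₀ = 4 * (4 * a ^ 2) + 16 * (8 * a ^ 2 * (1 + m₂) * h / l) + 1) (hMo : Mo = 8 * a ^ 2 * (1 + m₂))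
    (hF : 128 * (β / (2 * l) * (1 + Mo)) ^ 2 ≤ S₀) :
    ∃ Ccr ccr CR : ℝ, 0 < Ccr ∧ 0 < ccr ∧ 0 < CR ∧
      ∀ {R : ℕ}, M < R → ∀ {r : ℝ}, 0 < r → r ≤ 1 → CR ≤ ((R : ℝ) - M) * r ^ 2 →
      ∀ {𝔸 : Torus.Visc4 (Fin 3)}, Torus.NearIso 𝔸 (r ^ 3 * l) (r ^ 3 * h) → Torus.OddSmall 𝔸 (r ^ 3 * β) → ∀ {γ₁ : ℝ}, 0 ≤ γ₁ →
      ∀ {u : ℝ → Space R}, 2 / r ≤ (W₁.phase i).τ →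
        (∀ t ∈ Icc (W₁.start i) (W₁.start i + (W₁.phase i).τ), HasDerivAt u (((gen W₁ 𝔸 γ₁ R t).restrictScalars ℝ) (u t)) t) →
        u (W₁.start i) ∈ ladderSub R (ladder z₀ (W₁.phase i).m) →
        ‖u (W₁.start i + (W₁.phase i).τ)‖ ^ 2 ≤ Ccr * Real.exp (-(ccr * r ^ 2 * ((W₁.phase i).τ / 2))) * ‖u (W₁.start i)‖ ^ 2 := by
  have ha0 : 0 < a := by rw [ha]; exact ladderCoupling_pos W₁ i z₀ hhop
  have hm₂0 : 0 ≤ m₂ := by rw [hm₂]; exact freqNormSq_nonneg _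
  have hS₀0 : 0 < S₀ := by rw [hS₀]; positivity
  -- the cube root `κ`
  set κ : ℝ := (4 * Real.pi ^ 2 * l / (28 * S₀ ^ 2)) ^ (1 / 3 : ℝ) with hκ
  have hκ0 : 0 < κ := Real.rpow_pos_of_pos (by positivity) _
  have hκ3 : κ ^ 3 = 4 * Real.pi ^ 2 * l / (28 * S₀ ^ 2) := by
    rw [hκ, ← Real.rpow_natCast, ← Real.rpow_mul (by positivity)]
    norm_num
  -- the constants
  set CR : ℝ := 24 * κ * a ^ 2 / (Real.pi ^ 2 * l) with hCR
  set K₁ : ℝ := (1 + m₂) / (4 * a ^ 2) * (2 + 2 * a ^ 2) with hK₁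
  set K₃ : ℝ := (1 + m₂) / (4 * a ^ 2) * (6 * a ^ 2 / (4 * Real.pi ^ 2 * l * CR) + 4 * a ^ 2 / (4 * Real.pi ^ 2 * l * CR ^ 2)) with hK₃
  set c : ℝ := min (2 * Real.pi ^ 2 * l / (21 * S₀ * κ ^ 2)) (min (4 * Real.pi ^ 2 * l * a ^ 2 / (21 * (1 + m₂))) (min (1 / (6 * K₃)) (κ / (3 * K₁))))
    with hc
  have hCR0 : 0 < CR := by positivity
  have hK₁0 : 0 < K₁ := by positivity
  have hK₃0 : 0 < K₃ := by positivity
  have hc0 : 0 < c := lt_min (by positivity) (lt_min (by positivity) (lt_min (by positivity) (by positivity)))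
  refine ⟨3 * (1 + 7 * S₀ * κ ^ 2 / (8 * Real.pi ^ 2 * l)) * Real.exp c, c, CR, by positivity, hc0, hCR0, ?_⟩
  intro R hMR r hr hr1 hbox 𝔸 h𝔸 hoddA γ₁ hγ₁ u hτ hu h0
  exact (ladder_crush_slot_nu W₁ i z₀ hhop hM hMR hr hr1 hl hh hβ h𝔸 hoddA hγ₁ hτ hu h0 ha0 ha hm₂ hS₀ hMo hκ0 hκ3 hCR hK₁ hK₃ hc hF hbox).2

end Summit.AnomalousDissipation.AnomalousDissipation.Theorems.SolenoidalFractalHomogenisation.LagrangianStep.Sideband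

end
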